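import Summits.AtomisticToContinuum.HydrodynamicLimit.Theorems.BoxDissipativeWeakStrongLocalGibbsFineScaleStaticsPrelim
import Summits.AtomisticToContinuum.HydrodynamicLimit.Theorems.BoxDissipativeWeakStrongLocalGibbsFineScaleVelocity

/-!
# `LocalGibbsFineScale` (route `BoxDissipativeWeakStrong`), file 8: the fine-scale law of large
numbers for local Gibbs states (statics)

Support theorem for item stmt-AtomisticToContinuum-9905. For continuous profiles `a₀, θ₀ > 0`, `u₀`,
a reduced density `σ` in the cluster-expansion regime (`SmallDensity (profileOf a₀) σ`) and a family
of averaging kernels `g_N(x, ·)` (jointly measurable, `0 ≤ g_N ≤ C_N`, unit mass, supported in the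
sup-ball of radius `r_N → 0` around `x`, kinetic window `C_N/(N+1) → 0`), the empirical density,
momentum and energy fields of the `N+1`-particle local Gibbs state tested against `g_N(x, ·)` converge
to `(ρ₀, ρ₀ u₀, E(ρ₀, u₀, θ₀))(x)` in `L¹(P_N ⊗ dx)`:

  `∫ (∫ₓ |ρ̂_N(x) - ρ₀(x)| + ‖m̂_N(x) - ρ₀u₀(x)‖ + |Ê_N(x) - E₀(x)| dx) dP_N → 0`
  (`statics_kernel`, `ρ₀ = rhoLim (profileOf a₀) σ`).

Proof: `ofReal ∫ₓ ≤ ∫⁻ₓ ofReal`, Tonelli, and for every centre `x` the three expectations are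
`o(1)` uniformly in `x`: the density by file 5; momentum and energy by conditioning on the
positions (files 6–7): the Gaussian fluctuation is `√((C_N/(N+1)) · density)`, the drift terms
are controlled by the moduli of continuity of `u₀`, `|u₀|²/2 + 3θ₀/2` on the support of the kernel
and by the density deviation.

References: Spohn 1991, Part I §2.3 (local equilibrium and its law of large numbers).
-/

noncomputable section

namespace Summit.AtomisticToContinuum.HydrodynamicLimit.Theorems
namespace LGFS
open MeasureTheory ProbabilityTheory Finset Filter Topology Metric
open Literature.Probability.LatticeModels Literature.MathematicalPhysics.StatisticalMechanics
  Literature.MathematicalPhysics.KineticTheory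
open Literature.Analysis.FluidPDE (Config)
open scoped ENNReal

variable {a₀ θ₀ : T3 → ℝ} {u₀ : T3 → V3}

/-! ### Per-centre bounds for one kernel -/

section PerCentre

variable (ha : Continuous a₀) (hθ : Continuous θ₀) (hu : Continuous u₀) (ha0 : ∀ x, 0 < a₀ x)
  (hθ0 : ∀ x, 0 < θ₀ x) {σ : ℝ} (hσ2 : σ ≤ 1 / 2) (N : ℕ) {χ : T3 → ℝ} (hχ : Measurable χ) {C : ℝ}
  (hχ0 : ∀ y, 0 ≤ χ y) (hχC : ∀ y, χ y ≤ C)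
include ha hθ hu ha0 hθ0 hσ2 hχ hχ0 hχC

/-- **Density, per centre**: `∫⁻ ofReal |ρ̂(x) - ρ| dP_N = ofReal (E_{posGibbs} |(N+1)⁻¹∑χ(qᵢ) - ρ|)`. -/
theorem lintegral_density_dev_eq (ρ : ℝ) :
    ∫⁻ z, ENNReal.ofReal |empiricalDensityField z χ - ρ| ∂localGibbsMeasure σ a₀ u₀ θ₀ N =
      ENNReal.ofReal (∫ q, |((((N + 1 : ℕ) : ℝ))⁻¹ * ∑ i, χ (q i)) - ρ|
        ∂posGibbsMeasure a₀ (hsDiameter σ N) (N + 1)) := by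
  haveI := isProbabilityMeasure_posGibbsMeasure ha ha0 hσ2 N
  have hGm : Measurable fun q : Fin (N + 1) → T3 => ENNReal.ofReal |((((N + 1 : ℕ) : ℝ))⁻¹ * ∑ i, χ (q i)) - ρ| :=
    ((measurable_avg hχ).sub_const ρ).abs.ennreal_ofReal
  have h1 : (fun z : Config (N + 1) (Fin 3) T3 => ENNReal.ofReal |empiricalDensityField z χ - ρ|) =
      fun z => (fun q : Fin (N + 1) → T3 => ENNReal.ofReal |((((N + 1 : ℕ) : ℝ))⁻¹ * ∑ i, χ (q i)) - ρ|)
        (fun i => (z i).1) := by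
    funext z; rw [empiricalDensityField_eq_sum]
  rw [h1, lintegral_pos_localGibbsMeasure ha hθ hu (fun x => (ha0 x).le) hθ0 σ N hGm,
    ← ofReal_integral_eq_lintegral_ofReal _ (ae_of_all _ fun q => abs_nonneg _)]
  exact (integrable_const (C + |ρ|)).mono' ((measurable_avg hχ).sub_const ρ).abs.aestronglyMeasurable
    (ae_of_all _ fun q => by
      rw [Real.norm_eq_abs, abs_abs]
      exact (abs_sub _ _).trans (add_le_add (abs_avg_le hχ0 hχC q) le_rfl))

/-- **Momentum, per centre.** With `Θ ≥ θ₀`, `U ≥ ‖u₀‖`, a modulus `τ` of `u₀` on the support of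
`χ` around `x` (`χ y ≠ 0 → ‖u₀ y - u₀ x‖ ≤ τ`), and the `posGibbs` expectations
`E A ≤ Amax`, `E|A - ρ| ≤ δ₀` of the average `A = (N+1)⁻¹∑χ(qᵢ)`:
`∫⁻ ofReal ‖m̂(x) - ρ u₀(x)‖ dP_N ≤ ofReal (3 (√((N+1)⁻¹ C Θ) (1 + Amax)/2 + τ Amax + δ₀ U))`. -/
theorem lintegral_momentum_dev_le {Θ U τ Amax δ₀ ρ : ℝ} (hΘ : ∀ y, θ₀ y ≤ Θ) (hU : ∀ y, ‖u₀ y‖ ≤ U)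
    (hτ : 0 ≤ τ) {x : T3} (hmod : ∀ y, χ y ≠ 0 → ‖u₀ y - u₀ x‖ ≤ τ)
    (hA1 : ∫ q, ((((N + 1 : ℕ) : ℝ))⁻¹ * ∑ i, χ (q i)) ∂posGibbsMeasure a₀ (hsDiameter σ N) (N + 1) ≤ Amax)
    (hA2 : ∫ q, |((((N + 1 : ℕ) : ℝ))⁻¹ * ∑ i, χ (q i)) - ρ| ∂posGibbsMeasure a₀ (hsDiameter σ N) (N + 1) ≤ δ₀) :
    ∫⁻ z, ENNReal.ofReal ‖empiricalMomentumField z χ - ρ • u₀ x‖ ∂localGibbsMeasure σ a₀ u₀ θ₀ N ≤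
      ENNReal.ofReal (3 * (Real.sqrt ((((N + 1 : ℕ) : ℝ))⁻¹ * C * Θ) * (1 + Amax) / 2 + τ * Amax + δ₀ * U)) := by
  haveI := isProbabilityMeasure_posGibbsMeasure ha ha0 hσ2 N
  set n : ℕ := N + 1 with hn
  set PG := posGibbsMeasure a₀ (hsDiameter σ N) (N + 1) with hPG
  set κ := (((N + 1 : ℕ) : ℝ))⁻¹ * C * Θ with hκ
  have hΘ0 : 0 ≤ Θ := (hθ0 0).le.trans (hΘ 0)
  have hU0 : 0 ≤ U := (norm_nonneg _).trans (hU 0)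
  have hC0 : 0 ≤ C := (hχ0 x).trans (hχC x)
  have hκ0 : 0 ≤ κ := by positivity
  set A : (Fin (N + 1) → T3) → ℝ := fun q => (((N + 1 : ℕ) : ℝ))⁻¹ * ∑ i, χ (q i) with hA
  have hAm : Measurable A := measurable_avg hχ
  have hA0 : ∀ q, 0 ≤ A q := fun q => avg_nonneg hχ0 q
  have hAb : ∀ q, |A q| ≤ C := fun q => abs_avg_le hχ0 hχC q
  -- the conditional bound `b`
  set b : (Fin (N + 1) → T3) → ℝ := fun q =>
    3 * (Real.sqrt κ * (1 + A q) / 2 + τ * A q + |A q - ρ| * U) with hb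
  have hbm : Measurable b := by
    refine measurable_const.mul ((((measurable_const.mul (measurable_const.add hAm)).div_const 2).add
      (measurable_const.mul hAm)).add ((hAm.sub_const ρ).abs.mul_const U))
  have hb0 : ∀ q, 0 ≤ b q := fun q => by
    have := hA0 q; rw [hb]; positivity
  -- the velocity integral
  have hvel : ∀ q, ∫⁻ v, ENNReal.ofReal ‖empiricalMomentumField (zipConfig (q, v)) χ - ρ • u₀ x‖ ∂velMeasure u₀ θ₀ q ≤
      ENNReal.ofReal (b q) := by
    intro q
    obtain ⟨hint, hle⟩ := integral_norm_momentum_sub_le (u₀ := u₀) hθ0 q χ (ρ • u₀ x)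
    rw [← ofReal_integral_eq_lintegral_ofReal hint (ae_of_all _ fun v => norm_nonneg _)]
    refine ENNReal.ofReal_le_ofReal (hle.trans ?_)
    have hcoord : ∀ l : Fin 3, Real.sqrt (∑ i, ((((N + 1 : ℕ) : ℝ))⁻¹ * χ (q i)) ^ 2 * θ₀ (q i)) +
        |(((N + 1 : ℕ) : ℝ))⁻¹ * ∑ i, χ (q i) * u₀ (q i) l - (ρ • u₀ x) l| ≤
        Real.sqrt κ * (1 + A q) / 2 + τ * A q + |A q - ρ| * U := by
      intro l
      have h₁ : Real.sqrt (∑ i, ((((N + 1 : ℕ) : ℝ))⁻¹ * χ (q i)) ^ 2 * θ₀ (q i)) ≤ Real.sqrt κ * (1 + A q) / 2 :=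
        calc Real.sqrt (∑ i, ((((N + 1 : ℕ) : ℝ))⁻¹ * χ (q i)) ^ 2 * θ₀ (q i)) ≤ Real.sqrt (κ * A q) :=
              Real.sqrt_le_sqrt (sum_sq_mul_le (fun i => hχ0 _) (fun i => hχC _)
                (fun i => (hθ0 _).le) (fun i => hΘ _))
          _ ≤ Real.sqrt κ * (1 + A q) / 2 := sqrt_mul_le_half hκ0 (hA0 q)
      have h₂ : |(((N + 1 : ℕ) : ℝ))⁻¹ * ∑ i, χ (q i) * u₀ (q i) l - (ρ • u₀ x) l| ≤ τ * A q + |A q - ρ| * U := by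
        rw [PiLp.smul_apply, smul_eq_mul]
        have hmodl : ∀ y, χ y ≠ 0 → |u₀ y l - u₀ x l| ≤ τ := fun y hy => by
          have h2 : |(u₀ y - u₀ x) l| ≤ ‖u₀ y - u₀ x‖ := by simpa using PiLp.norm_apply_le (u₀ y - u₀ x) l
          rw [PiLp.sub_apply] at h2
          exact h2.trans (hmod y hy)
        have h3 := abs_avg_mul_sub_le (f := fun y => u₀ y l) (ρ := ρ) hχ0 hmodl q
        have h4 : |u₀ x l| ≤ U := by
          have h2 : |u₀ x l| ≤ ‖u₀ x‖ := by simpa using PiLp.norm_apply_le (u₀ x) l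
          exact h2.trans (hU x)
        have h5 : |(((N + 1 : ℕ) : ℝ))⁻¹ * ∑ i, χ (q i) - ρ| * |u₀ x l| ≤ |A q - ρ| * U :=
          mul_le_mul_of_nonneg_left h4 (abs_nonneg _)
        exact h3.trans (add_le_add le_rfl h5)
      linarith
    calc ∑ l, (Real.sqrt (∑ i, ((((N + 1 : ℕ) : ℝ))⁻¹ * χ (q i)) ^ 2 * θ₀ (q i)) +
          |(((N + 1 : ℕ) : ℝ))⁻¹ * ∑ i, χ (q i) * u₀ (q i) l - (ρ • u₀ x) l|)
        ≤ ∑ _l : Fin 3, (Real.sqrt κ * (1 + A q) / 2 + τ * A q + |A q - ρ| * U) := sum_le_sum fun l _ => hcoord l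
      _ = b q := by rw [sum_const, card_univ, Fintype.card_fin, nsmul_eq_mul, hb]; norm_num
  -- integrate over the positions
  have hGm : Measurable fun z : Config (N + 1) (Fin 3) T3 => ENNReal.ofReal ‖empiricalMomentumField z χ - ρ • u₀ x‖ :=
    ((measurable_empiricalMomentumField hχ).sub_const _).norm.ennreal_ofReal
  refine (lintegral_localGibbsMeasure_le_of_vel ha hθ hu (fun y => (ha0 y).le) hθ0 σ N hGm hbm hvel).trans ?_
  have hbint : Integrable b PG :=
    (integrable_const (3 * (Real.sqrt κ * (1 + C) / 2 + τ * C + (C + |ρ|) * U))).mono' hbm.aestronglyMeasurable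
      (ae_of_all _ fun q => by
        rw [Real.norm_eq_abs, abs_of_nonneg (hb0 q)]
        simp only [hb]
        have h1 : A q ≤ C := (le_abs_self _).trans (hAb q)
        have h2 : |A q - ρ| ≤ C + |ρ| := (abs_sub _ _).trans (add_le_add (hAb q) le_rfl)
        have h3 : 0 ≤ Real.sqrt κ := Real.sqrt_nonneg κ
        nlinarith [mul_le_mul_of_nonneg_left h2 hU0, mul_le_mul_of_nonneg_left h1 hτ,
          mul_le_mul_of_nonneg_left h1 h3])
  rw [← ofReal_integral_eq_lintegral_ofReal hbint (ae_of_all _ hb0)]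
  refine ENNReal.ofReal_le_ofReal ?_
  have hIA : Integrable A PG := (integrable_const C).mono' hAm.aestronglyMeasurable
    (ae_of_all _ fun q => (Real.norm_eq_abs _).le.trans (hAb q))
  have hIAρ : Integrable (fun q => |A q - ρ|) PG := (integrable_const (C + |ρ|)).mono'
    (hAm.sub_const ρ).abs.aestronglyMeasurable (ae_of_all _ fun q => by
      rw [Real.norm_eq_abs, abs_abs]; exact (abs_sub _ _).trans (add_le_add (hAb q) le_rfl))
  have hI1 : Integrable (fun q => Real.sqrt κ * (1 + A q) / 2) PG :=
    (((integrable_const (1 : ℝ)).add hIA).const_mul (Real.sqrt κ)).div_const 2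
  have hI2 : Integrable (fun q => τ * A q) PG := hIA.const_mul τ
  have hI3 : Integrable (fun q => |A q - ρ| * U) PG := hIAρ.mul_const U
  have hcalc : ∫ q, b q ∂PG = 3 * (Real.sqrt κ * (1 + ∫ q, A q ∂PG) / 2 + τ * ∫ q, A q ∂PG +
      (∫ q, |A q - ρ| ∂PG) * U) := by
    have hI12 : Integrable (fun q => Real.sqrt κ * (1 + A q) / 2 + τ * A q) PG := hI1.add hI2
    simp only [hb]
    rw [integral_const_mul, integral_add hI12 hI3, integral_add hI1 hI2, integral_mul_const,
      integral_const_mul, integral_div, integral_const_mul, integral_add (integrable_const _) hIA,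
      integral_const, probReal_univ, one_smul]
  rw [hcalc]
  have h3 : 0 ≤ Real.sqrt κ := Real.sqrt_nonneg κ
  nlinarith [mul_le_mul_of_nonneg_left hA1 hτ, mul_le_mul_of_nonneg_left hA1 h3,
    mul_le_mul_of_nonneg_right hA2 hU0]

/-- **Energy, per centre.** With `e = |u₀|²/2 + 3θ₀/2`, `B ≥` the kinetic-energy variance bound,
`Ee ≥ |e|`, a modulus `τ` of `e` on the support of `χ` around `x`, and `E A ≤ Amax`, `E|A - ρ| ≤ δ₀`:
`∫⁻ ofReal |Ê(x) - ρ e(x)| dP_N ≤ ofReal (√((N+1)⁻¹ C B)(1 + Amax)/2 + τ Amax + δ₀ Ee)`. -/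
theorem lintegral_energy_dev_le {B Ee τ Amax δ₀ ρ : ℝ}
    (hB : ∀ y, 2 * 3 * θ₀ y * ‖u₀ y‖ ^ 2 + θ₀ y ^ 2 / 2 * gaussFourthMomentConst (Fin 3) ≤ B)
    (hEe : ∀ y, |‖u₀ y‖ ^ 2 / 2 + Fintype.card (Fin 3) * θ₀ y / 2| ≤ Ee) (hτ : 0 ≤ τ) {x : T3}
    (hmod : ∀ y, χ y ≠ 0 → |(‖u₀ y‖ ^ 2 / 2 + Fintype.card (Fin 3) * θ₀ y / 2) -
      (‖u₀ x‖ ^ 2 / 2 + Fintype.card (Fin 3) * θ₀ x / 2)| ≤ τ)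
    (hA1 : ∫ q, ((((N + 1 : ℕ) : ℝ))⁻¹ * ∑ i, χ (q i)) ∂posGibbsMeasure a₀ (hsDiameter σ N) (N + 1) ≤ Amax)
    (hA2 : ∫ q, |((((N + 1 : ℕ) : ℝ))⁻¹ * ∑ i, χ (q i)) - ρ| ∂posGibbsMeasure a₀ (hsDiameter σ N) (N + 1) ≤ δ₀) :
    ∫⁻ z, ENNReal.ofReal |empiricalEnergyField z χ - ρ * (‖u₀ x‖ ^ 2 / 2 + Fintype.card (Fin 3) * θ₀ x / 2)|
        ∂localGibbsMeasure σ a₀ u₀ θ₀ N ≤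
      ENNReal.ofReal (Real.sqrt ((((N + 1 : ℕ) : ℝ))⁻¹ * C * B) * (1 + Amax) / 2 + τ * Amax + δ₀ * Ee) := by
  haveI := isProbabilityMeasure_posGibbsMeasure ha ha0 hσ2 N
  set PG := posGibbsMeasure a₀ (hsDiameter σ N) (N + 1) with hPG
  set κ := (((N + 1 : ℕ) : ℝ))⁻¹ * C * B with hκ
  set e : T3 → ℝ := fun y => ‖u₀ y‖ ^ 2 / 2 + Fintype.card (Fin 3) * θ₀ y / 2 with he
  have hB0 : 0 ≤ B := (energyVarBound_nonneg (u₀ := u₀) hθ0 0).trans (hB 0)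
  have hEe0 : 0 ≤ Ee := (abs_nonneg _).trans (hEe 0)
  have hC0 : 0 ≤ C := (hχ0 x).trans (hχC x)
  have hκ0 : 0 ≤ κ := by positivity
  set A : (Fin (N + 1) → T3) → ℝ := fun q => (((N + 1 : ℕ) : ℝ))⁻¹ * ∑ i, χ (q i) with hA
  have hAm : Measurable A := measurable_avg hχ
  have hA0 : ∀ q, 0 ≤ A q := fun q => avg_nonneg hχ0 q
  have hAb : ∀ q, |A q| ≤ C := fun q => abs_avg_le hχ0 hχC q
  set b : (Fin (N + 1) → T3) → ℝ := fun q =>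
    Real.sqrt κ * (1 + A q) / 2 + τ * A q + |A q - ρ| * Ee with hb
  have hbm : Measurable b :=
    (((measurable_const.mul (measurable_const.add hAm)).div_const 2).add (measurable_const.mul hAm)).add
      ((hAm.sub_const ρ).abs.mul_const Ee)
  have hb0 : ∀ q, 0 ≤ b q := fun q => by
    have := hA0 q; rw [hb]; positivity
  have hvel : ∀ q, ∫⁻ v, ENNReal.ofReal |empiricalEnergyField (zipConfig (q, v)) χ - ρ * e x| ∂velMeasure u₀ θ₀ q ≤
      ENNReal.ofReal (b q) := by
    intro q
    obtain ⟨hint, hle⟩ := integral_abs_energy_sub_le (u₀ := u₀) hθ0 q χ (ρ * e x)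
    rw [← ofReal_integral_eq_lintegral_ofReal hint (ae_of_all _ fun v => abs_nonneg _)]
    have h₁ : Real.sqrt (∑ i, ((((N + 1 : ℕ) : ℝ))⁻¹ * χ (q i)) ^ 2 *
        (2 * 3 * θ₀ (q i) * ‖u₀ (q i)‖ ^ 2 + θ₀ (q i) ^ 2 / 2 * gaussFourthMomentConst (Fin 3))) ≤
        Real.sqrt κ * (1 + A q) / 2 :=
      calc Real.sqrt (∑ i, ((((N + 1 : ℕ) : ℝ))⁻¹ * χ (q i)) ^ 2 *
            (2 * 3 * θ₀ (q i) * ‖u₀ (q i)‖ ^ 2 + θ₀ (q i) ^ 2 / 2 * gaussFourthMomentConst (Fin 3)))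
          ≤ Real.sqrt (κ * A q) :=
            Real.sqrt_le_sqrt (sum_sq_mul_le (fun i => hχ0 _) (fun i => hχC _)
              (fun i => energyVarBound_nonneg (u₀ := u₀) hθ0 _) (fun i => hB _))
        _ ≤ Real.sqrt κ * (1 + A q) / 2 := sqrt_mul_le_half hκ0 (hA0 q)
    have h₂ : |(((N + 1 : ℕ) : ℝ))⁻¹ * ∑ i, χ (q i) * (‖u₀ (q i)‖ ^ 2 / 2 + Fintype.card (Fin 3) * θ₀ (q i) / 2) -
        ρ * e x| ≤ τ * A q + |A q - ρ| * Ee := by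
      have h3 := abs_avg_mul_sub_le (f := e) (ρ := ρ) hχ0 (fun y hy => hmod y hy) q
      have h5 : |(((N + 1 : ℕ) : ℝ))⁻¹ * ∑ i, χ (q i) - ρ| * |e x| ≤ |A q - ρ| * Ee :=
        mul_le_mul_of_nonneg_left (hEe x) (abs_nonneg _)
      have h6 := h3.trans (add_le_add le_rfl h5)
      simpa only [he] using h6
    refine ENNReal.ofReal_le_ofReal (hle.trans ?_)
    show _ ≤ Real.sqrt κ * (1 + A q) / 2 + τ * A q + |A q - ρ| * Ee
    simp only [he] at h₂ ⊢
    linarith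
  have hGm : Measurable fun z : Config (N + 1) (Fin 3) T3 => ENNReal.ofReal |empiricalEnergyField z χ - ρ * e x| :=
    ((measurable_empiricalEnergyField hχ).sub_const _).abs.ennreal_ofReal
  refine (lintegral_localGibbsMeasure_le_of_vel ha hθ hu (fun y => (ha0 y).le) hθ0 σ N hGm hbm hvel).trans ?_
  have hbint : Integrable b PG :=
    (integrable_const (Real.sqrt κ * (1 + C) / 2 + τ * C + (C + |ρ|) * Ee)).mono' hbm.aestronglyMeasurable
      (ae_of_all _ fun q => by
        rw [Real.norm_eq_abs, abs_of_nonneg (hb0 q)]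
        simp only [hb]
        have h1 : A q ≤ C := (le_abs_self _).trans (hAb q)
        have h2 : |A q - ρ| ≤ C + |ρ| := (abs_sub _ _).trans (add_le_add (hAb q) le_rfl)
        have h3 : 0 ≤ Real.sqrt κ := Real.sqrt_nonneg κ
        nlinarith [mul_le_mul_of_nonneg_left h2 hEe0, mul_le_mul_of_nonneg_left h1 hτ,
          mul_le_mul_of_nonneg_left h1 h3])
  rw [← ofReal_integral_eq_lintegral_ofReal hbint (ae_of_all _ hb0)]
  refine ENNReal.ofReal_le_ofReal ?_
  have hIA : Integrable A PG := (integrable_const C).mono' hAm.aestronglyMeasurable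
    (ae_of_all _ fun q => (Real.norm_eq_abs _).le.trans (hAb q))
  have hIAρ : Integrable (fun q => |A q - ρ|) PG := (integrable_const (C + |ρ|)).mono'
    (hAm.sub_const ρ).abs.aestronglyMeasurable (ae_of_all _ fun q => by
      rw [Real.norm_eq_abs, abs_abs]; exact (abs_sub _ _).trans (add_le_add (hAb q) le_rfl))
  have hI1 : Integrable (fun q => Real.sqrt κ * (1 + A q) / 2) PG :=
    (((integrable_const (1 : ℝ)).add hIA).const_mul (Real.sqrt κ)).div_const 2
  have hI2 : Integrable (fun q => τ * A q) PG := hIA.const_mul τ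
  have hI3 : Integrable (fun q => |A q - ρ| * Ee) PG := hIAρ.mul_const Ee
  have hcalc : ∫ q, b q ∂PG = Real.sqrt κ * (1 + ∫ q, A q ∂PG) / 2 + τ * ∫ q, A q ∂PG +
      (∫ q, |A q - ρ| ∂PG) * Ee := by
    have hI12 : Integrable (fun q => Real.sqrt κ * (1 + A q) / 2 + τ * A q) PG := hI1.add hI2
    simp only [hb]
    rw [integral_add hI12 hI3, integral_add hI1 hI2, integral_mul_const,
      integral_const_mul, integral_div, integral_const_mul, integral_add (integrable_const _) hIA,
      integral_const, probReal_univ, one_smul]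
  rw [hcalc]
  have h3 : 0 ≤ Real.sqrt κ := Real.sqrt_nonneg κ
  nlinarith [mul_le_mul_of_nonneg_left hA1 hτ, mul_le_mul_of_nonneg_left hA1 h3,
    mul_le_mul_of_nonneg_right hA2 hEe0]

end PerCentre

end LGFS
end Summit.AtomisticToContinuum.HydrodynamicLimit.Theorems
end
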